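import Summits.ResolutionOfSingularities.ResolutionOfSingularities.Theorems.FrobeniusLadderFInjectiveMacaulayficationFanCheckSoundBinders
import Mathlib.RingTheory.Ideal.Quotient.Operations
import HarnessLib

/-!
# Fan-check kit, PRODUCT CENTRES in list currency: the generator table of `𝔪·K` GENERATED from the table of `K` (`prodGens`), and the ideal identity
# `span (x^A) = span (range x̄ⱼ) · span (x^K)` modulo any `F` (crux `FInjectiveMacaulayfication` stmt-ResolutionOfSingularities-15315, chain w45a;
# (W-TD) BED D storey 1 (D-1), res-L1-w45a-plan-1 R21.18 (4); seat res-L1-w45a-stub-2 g10)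

[OURS · L1 W4.5a] Support file (`--supports stmt-ResolutionOfSingularities-15315 --as helper`); generic glue for the road-B data kit
`FanCheckKit` / `FanCheckSound` (res-L1-w45a-stub-4); NOT a statement of any manuscript; AI-written (AI review is weaker than expert review).

WHY. The F-half rows blow up PRODUCT centres `𝔪·K` (so that the row composes with the floor `𝔪`, Stacks 080A); the earlier fan modules carried the
generators `A` of `𝔪·K` AND the generators of `K` as two literal tables plus two witnessed divisibility tables (`hprodTables`). At BED D storey 1
(`|K| ≈ 2·10³`, `|A| ≈ 10⁴`) the literal `A` and the witness lookups are the dominant kernel cost; this file DEFINES the two-level generator table of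
`𝔪·K` from the two-level table of `K` — `prodGens n KL2 = [ b + e_j : j < n, b ∈ KL2 ]` (chunked `j`-major) — and proves the product identity once:
`span_genSet_prodGens`: in `k[X]/F` (any `F`), `span (x^(genSet (prodGens n KL2))) = span (range x̄ⱼ) * span (x^(genSet KL2))`.
Definitions are computable list programs (no instances, no notation); no named facts. [folklore; cite: CoxLittleSchenck2011, §2.3 (context)]
-/

-- single-problem summit: the doubled namespace component is forced
set_option linter.dupNamespace false

namespace Summit.ResolutionOfSingularities.ResolutionOfSingularities.Theorems.FInjectiveMacaulayfication.FanCheckProduct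

open Summit.ResolutionOfSingularities.ResolutionOfSingularities.Theorems.FInjectiveMacaulayfication
open FanCheckKit FanCheckSound MvPolynomial

/-! ## §1 The list program -/

/-- The two-level generator table of the product centre `𝔪·K` from the two-level table of `K`: chunks `[b + e_j : b ∈ chunk]`, `j`-major. [folklore] -/
def prodGens (n : ℕ) (KL2 : List (List (List ℕ))) : List (List (List ℕ)) :=
  (List.range n).flatMap fun j => KL2.map fun ch => ch.map fun b => addUnitL b j

/-! ## §2 Membership and the product identity -/

variable {n : ℕ}

/-- Membership in the flattened product table. [folklore] -/
theorem mem_flatten_prodGens {KL2 : List (List (List ℕ))} {v : List ℕ} :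
    v ∈ (prodGens n KL2).flatten ↔ ∃ j < n, ∃ b ∈ KL2.flatten, v = addUnitL b j := by
  simp only [prodGens, List.mem_flatten, List.mem_flatMap, List.mem_range, List.mem_map]
  constructor
  · rintro ⟨_, ⟨j, hj, ch, hch, rfl⟩, hv⟩
    obtain ⟨b, hb, rfl⟩ := List.mem_map.mp hv
    exact ⟨j, hj, b, ⟨ch, hch, hb⟩, rfl⟩
  · rintro ⟨j, hj, b, ⟨ch, hch, hb⟩, rfl⟩
    exact ⟨_, ⟨j, hj, ch, hch, rfl⟩, List.mem_map.mpr ⟨b, hb, rfl⟩⟩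

/-- Every vector of the product table has length `n` if every vector of `K`'s table has. [folklore] -/
theorem length_of_mem_prodGens {KL2 : List (List (List ℕ))} (hlen : ∀ b ∈ KL2.flatten, b.length = n) :
    ∀ v ∈ (prodGens n KL2).flatten, v.length = n := by
  intro v hv
  obtain ⟨j, -, b, hb, rfl⟩ := mem_flatten_prodGens.mp hv
  rw [length_addUnitL, hlen b hb]

/-- `expOf` of `b + e_j` (for `b` of length `n`, `j < n`). [folklore] -/
theorem expOf_addUnitL (b : List ℕ) (hb : b.length = n) (j : Fin n) :
    expOf n (addUnitL b j.1) = expOf n b + Finsupp.single j 1 := by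
  ext i
  rw [Finsupp.add_apply, coe_expOf, coe_expOf, vecOf, vecOf, getL_addUnitL b j.1 i.1 (by rw [hb]; exact i.2),
    Finsupp.single_apply]
  by_cases h : j = i
  · subst h; simp
  · have h' : i.1 ≠ j.1 := fun e => h (Fin.ext e.symm)
    simp [h, h']

/-- ★ **THE PRODUCT IDENTITY**: in `k[X]/F` (any ideal `F`), the monomial ideal of the product table is the product `(x̄ⱼ : j) · (x^b : b ∈ K)`.
[folklore; cite: CoxLittleSchenck2011, §2.3 (context)] -/
theorem span_genSet_prodGens (k : Type) [CommRing k] (F : Ideal (MvPolynomial (Fin n) k)) (KL2 : List (List (List ℕ)))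
    (hlen : ∀ b ∈ KL2.flatten, b.length = n) :
    Ideal.span ((fun e : Fin n →₀ ℕ => Ideal.Quotient.mk F (monomial e (1 : k))) '' (genSet n (prodGens n KL2) : Set (Fin n →₀ ℕ))) =
      Ideal.span (Set.range fun j : Fin n => Ideal.Quotient.mk F (X j)) *
        Ideal.span ((fun e : Fin n →₀ ℕ => Ideal.Quotient.mk F (monomial e (1 : k))) '' (genSet n KL2 : Set (Fin n →₀ ℕ))) := by
  classical
  have key : ∀ (b : List ℕ), b.length = n → ∀ j : Fin n,
      Ideal.Quotient.mk F (monomial (expOf n (addUnitL b j.1)) (1 : k)) =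
        Ideal.Quotient.mk F (X j) * Ideal.Quotient.mk F (monomial (expOf n b) (1 : k)) := by
    intro b hb j
    rw [expOf_addUnitL b hb j, ← map_mul, X, monomial_mul, one_mul, add_comm]
  apply le_antisymm
  · rw [Ideal.span_le]
    rintro _ ⟨e, he, rfl⟩
    obtain ⟨v, hv, rfl⟩ := exists_of_mem_genSet (Finset.mem_coe.mp he)
    obtain ⟨j, hj, b, hb, rfl⟩ := mem_flatten_prodGens.mp hv
    rw [SetLike.mem_coe]
    beta_reduce
    rw [key b (hlen b hb) ⟨j, hj⟩]
    exact Ideal.mul_mem_mul (Ideal.subset_span ⟨⟨j, hj⟩, rfl⟩)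
      (Ideal.subset_span ⟨_, Finset.mem_coe.mpr (expOf_mem_genSet hb), rfl⟩)
  · rw [Ideal.span_mul_span', Ideal.span_le]
    rintro _ ⟨_, ⟨j, rfl⟩, _, ⟨e, he, rfl⟩, rfl⟩
    obtain ⟨b, hb, rfl⟩ := exists_of_mem_genSet (Finset.mem_coe.mp he)
    rw [SetLike.mem_coe]
    beta_reduce
    rw [← key b (hlen b hb) j]
    exact Ideal.subset_span ⟨_, Finset.mem_coe.mpr (expOf_mem_genSet (mem_flatten_prodGens.mpr ⟨j.1, j.2, b, hb, rfl⟩)), rfl⟩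

/-- Pure powers in the product table: if `N • e_j ∈ K`'s table (as the vector `b` with `b_j = N`, zero elsewhere... given positionally) then
`(N+1) • e_j` is a generator of `𝔪·K`; packaged as the `hprim` binder from an explicit list of members. [folklore] -/
theorem single_mem_genSet_prodGens {KL2 : List (List (List ℕ))} (hlen : ∀ b ∈ KL2.flatten, b.length = n) (j : Fin n) (N : ℕ)
    (b : List ℕ) (hb : b ∈ KL2.flatten) (hbj : expOf n b = Finsupp.single j N) :
    Finsupp.single j (N + 1) ∈ genSet n (prodGens n KL2) := by
  have h := expOf_mem_genSet (n := n) (mem_flatten_prodGens.mpr ⟨j.1, j.2, b, hb, rfl⟩)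
  rwa [expOf_addUnitL b (hlen b hb) j, hbj, ← Finsupp.single_add] at h

end Summit.ResolutionOfSingularities.ResolutionOfSingularities.Theorems.FInjectiveMacaulayfication.FanCheckProduct
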